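import Summits.CriticalPhenomena.PercolationContinuityZ3.Theorems.SahiMasterFamilyPointwiseCoordinateGluingSettled
import Mathlib.Tactic.Linarith
import Mathlib.Tactic.Ring
import HarnessLib

/-!
# `NoHeavyLowerTail` (crux stmt-CriticalPhenomena-4575), master-family line P2: SINGLE-MEMBER DISJUNCTIVE GLUING WITH ARBITRARY CO-DEPENDENCE —
# the one-coordinate Bernstein form of `E_3(A ∪ {e∈ω}, B, C)` for `B, C` ARBITRARY in `e`, with explicit nonnegative pieces

Support file (seat `prim-masterthm-p2`, gen 11; `--supports stmt-CriticalPhenomena-4575`); no definition, no sorry.  Memo SAHI-ROUTE.md §4.34.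

Write `t = p_e`, `m = μ_p`, `X^b = secAt e b X` for the two `e`-sections, `S_e = {ω | e ∈ ω}`.  For an `e`-free event `A` and events `B, C` with ARBITRARY
dependence on `e` (`sahiE_three_unionCoord_one_arb`, a `ring` identity after one-coordinate conditioning):
  `E_3(1_{A ∪ S_e}, 1_B, 1_C) = (1−t)³·E_3(1_A, 1_{B⁰}, 1_{C⁰}) + t(1−t)²·X₁ + t²(1−t)·X₂ + t³·[m(B¹∩C¹) − mB¹·mC¹]`,
  `X₂ = (2 − mA)·[m(B¹∩C¹) − mB¹mC¹] + W`,   `X₁ = E_3(1_A,1_{B⁰},1_{C⁰}) + (1 − mA)·[m(B¹∩C¹) − mB¹mC¹] + W + (1 − mA)(mB¹ − mB⁰)(mC¹ − mC⁰)`,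
  `W = [m(A∩B¹∩C⁰) − m(A∩C⁰)·mB¹] + [m(A∩B⁰∩C¹) − m(A∩B⁰)·mC¹]`
      `+ [m(B¹∩C⁰) − m(B⁰∩C⁰) − m(A∩B¹∩C⁰) + m(A∩B⁰∩C⁰)] + [m(B⁰∩C¹) − m(B⁰∩C⁰) − m(A∩B⁰∩C¹) + m(A∩B⁰∩C⁰)]`
      `+ [m(B¹∩C¹) − m(B¹∩C⁰) − m(B⁰∩C¹) + m(B⁰∩C⁰)]`.
For INCREASING `A, B, C` every bracket is `≥ 0`: Harris covariances `Cov(B¹,C¹)`, `Cov(A∩C⁰, B¹)`, `Cov(A∩B⁰, C¹)`, the Venn cells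
`m(Aᶜ ∩ (B¹∖B⁰) ∩ C⁰)`, `m(Aᶜ ∩ B⁰ ∩ (C¹∖C⁰))`, `m((B¹∖B⁰) ∩ (C¹∖C⁰))` (pivotal sets!), and influences `mX¹ − mX⁰ ≥ 0` (`cell_nonneg`, `cell_nonneg'`).
CONSEQUENCES: (i) `sahiE_three_unionCoord_one_arb_nonneg` — **`C_3` passes from the single minor `(A, B⁰, C⁰)` to `(A ∪ S_e, B, C)`: OR-ing a coordinate into
ONE member preserves `E_3 ≥ 0` whatever the other two members do with that coordinate** (master-conj's (B) `Pointwise.sahiE_three_unionCoord_two_free` needs TWO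
members implied by `e`; P3's `SahiCombDisjunct.sahiE_three_unionCoord_one` / `SahiCombMix.combHereditary_orCoord_sel` need the other members `e`-free); (ii) the
degree-3 Bernstein coefficients of `t ↦ E_3` along `e` are `[E_3(minor), X₁/3, X₂/3, Cov(B¹,C¹)]` with `X₁ ≥ E_3(minor)`, `X₂ ≥ 0` — master-conj's "Bernstein-good
coordinate" hypothesis (`Pointwise.masterFamilyNonneg_three_of_bernsteinGoodCoordinate`) holds at every coordinate IMPLIED by one member, given `C_3` of the minor.
With (A) (`Pointwise.sahiE_three_interCoord_eq`: a member REQUIRING `e`) the coordinate types not covered by an explicit nonnegative Bernstein form are exactly those at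
which at least two members depend on `e` non-trivially in both sections ("mixed") and none requires or is implied by `e` (memo §4.34: the K₄ perfect-matching triple).
HONEST FRAMING: identities and an inheritance theorem; Kahn's Conjecture 5 / Sahi's `C_3` remain OPEN.  Axioms standard. [this work]
-/

noncomputable section

open scoped Classical

namespace Summit.CriticalPhenomena.PercolationContinuityZ3.Theorems

namespace SahiCoordinateGluing

open Finset Function
open Literature.Combinatorics.Sahi2008
open Literature.Probability.Percolation.DecisionTree (ind ind_of_mem ind_of_not_mem ind_nonneg)
open SahiCombDisjunct

variable {ι : Type} [Fintype ι]

/-! ### 0. Two Venn-cell atoms built from a nested pair (pivotal sets) -/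

/-- **Mixed Venn cell**: for `X ⊆ Y` (e.g. the two sections of an increasing event) and any `D, Z`,
`m(Y∩Z) − m(X∩Z) − m(D∩Y∩Z) + m(D∩X∩Z) = m(Dᶜ ∩ (Y∖X) ∩ Z) ≥ 0`. [this work] -/
theorem cell_nonneg (p : ι → unitInterval) {X Y : Set (Set ι)} (hXY : X ⊆ Y) (D Z : Set (Set ι)) :
    0 ≤ ex (bernoulliWeight p) (ind (Y ∩ Z)) - ex (bernoulliWeight p) (ind (X ∩ Z))
      - ex (bernoulliWeight p) (ind (D ∩ Y ∩ Z)) + ex (bernoulliWeight p) (ind (D ∩ X ∩ Z)) := by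
  have hf : ind (Y ∩ Z) - ind (X ∩ Z) - ind (D ∩ Y ∩ Z) + ind (D ∩ X ∩ Z) =
      fun ω => ind Dᶜ ω * ind Z ω * ind (Y \ X) ω := by
    funext ω
    simp only [Pi.add_apply, Pi.sub_apply, Literature.Probability.Percolation.BHK2006.ind_inter, ind_compl_apply,
      Pointwise.ind_sdiff_of_subset hXY]
    ring
  have h : 0 ≤ ex (bernoulliWeight p) (ind (Y ∩ Z) - ind (X ∩ Z) - ind (D ∩ Y ∩ Z) + ind (D ∩ X ∩ Z)) := by
    rw [hf]
    exact ex_nonneg (isFKGMeasure_bernoulliWeight p).nonneg fun ω =>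
      mul_nonneg (mul_nonneg (ind_nonneg _ _) (ind_nonneg _ _)) (ind_nonneg _ _)
  rw [ex_add, ex_sub', ex_sub'] at h
  exact h

/-- **Product of two pivotal sets**: for `X ⊆ Y` and `T ⊆ Z`, `m(Y∩Z) − m(Y∩T) − m(X∩Z) + m(X∩T) = m((Y∖X) ∩ (Z∖T)) ≥ 0`. [this work] -/
theorem cell_nonneg' (p : ι → unitInterval) {X Y T Z : Set (Set ι)} (hXY : X ⊆ Y) (hTZ : T ⊆ Z) :
    0 ≤ ex (bernoulliWeight p) (ind (Y ∩ Z)) - ex (bernoulliWeight p) (ind (Y ∩ T))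
      - ex (bernoulliWeight p) (ind (X ∩ Z)) + ex (bernoulliWeight p) (ind (X ∩ T)) := by
  have hf : ind (Y ∩ Z) - ind (Y ∩ T) - ind (X ∩ Z) + ind (X ∩ T) =
      fun ω => ind (Y \ X) ω * ind (Z \ T) ω := by
    funext ω
    simp only [Pi.add_apply, Pi.sub_apply, Literature.Probability.Percolation.BHK2006.ind_inter, Pointwise.ind_sdiff_of_subset hXY,
      Pointwise.ind_sdiff_of_subset hTZ]
    ring
  have h : 0 ≤ ex (bernoulliWeight p) (ind (Y ∩ Z) - ind (Y ∩ T) - ind (X ∩ Z) + ind (X ∩ T)) := by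
    rw [hf]
    exact ex_nonneg (isFKGMeasure_bernoulliWeight p).nonneg fun ω => mul_nonneg (ind_nonneg _ _) (ind_nonneg _ _)
  rw [ex_add, ex_sub', ex_sub'] at h
  exact h

/-! ### 1. The identity: `E_3(A ∪ {e ∈ ω}, B, C)` with `A` free of `e` and `B, C` arbitrary -/

section Identity

variable (p : ι → unitInterval) (e : ι) (A B C : Set (Set ι)) (hAe : ∀ b : Bool, secAt e b A = A)
include hAe

attribute [local simp] secAt_inter secAt_union secAt_true_coord secAt_false_coord

/-- **Single-member disjunctive gluing, the other members ARBITRARY in `e`.**  For an `e`-free event `A` and events `B, C`, with `t = p_e`,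
`X^b = secAt e b X`, `m = μ_p`:
`E_3(1_{A∪{e∈ω}}, 1_B, 1_C) = (1−t)³·E_3(1_A,1_{B⁰},1_{C⁰}) + t(1−t)²·X₁ + t²(1−t)·X₂ + t³·(m(B¹∩C¹) − mB¹mC¹)` with `X₁, X₂` the explicit moment
combinations displayed (module docstring); no monotonicity is needed for the identity. [this work] -/
theorem sahiE_three_unionCoord_one_arb :
    sahiE (bernoulliWeight p) 3 ![ind (A ∪ {ω : Set ι | e ∈ ω}), ind B, ind C] =
      (1 - (p e : ℝ)) ^ 3 * sahiE (bernoulliWeight p) 3 ![ind A, ind (secAt e false B), ind (secAt e false C)]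
      + (p e : ℝ) * (1 - (p e : ℝ)) ^ 2 *
        ( sahiE (bernoulliWeight p) 3 ![ind A, ind (secAt e false B), ind (secAt e false C)]
          + (1 - ex (bernoulliWeight p) (ind A)) *
              (ex (bernoulliWeight p) (ind (secAt e true B ∩ secAt e true C))
                - ex (bernoulliWeight p) (ind (secAt e true B)) * ex (bernoulliWeight p) (ind (secAt e true C)))
          + ( (ex (bernoulliWeight p) (ind (A ∩ secAt e true B ∩ secAt e false C))
                  - ex (bernoulliWeight p) (ind (A ∩ secAt e false C)) * ex (bernoulliWeight p) (ind (secAt e true B)))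
              + (ex (bernoulliWeight p) (ind (A ∩ secAt e false B ∩ secAt e true C))
                  - ex (bernoulliWeight p) (ind (A ∩ secAt e false B)) * ex (bernoulliWeight p) (ind (secAt e true C)))
              + (ex (bernoulliWeight p) (ind (secAt e true B ∩ secAt e false C)) - ex (bernoulliWeight p) (ind (secAt e false B ∩ secAt e false C))
                  - ex (bernoulliWeight p) (ind (A ∩ secAt e true B ∩ secAt e false C))
                  + ex (bernoulliWeight p) (ind (A ∩ secAt e false B ∩ secAt e false C)))
              + (ex (bernoulliWeight p) (ind (secAt e false B ∩ secAt e true C)) - ex (bernoulliWeight p) (ind (secAt e false B ∩ secAt e false C))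
                  - ex (bernoulliWeight p) (ind (A ∩ secAt e false B ∩ secAt e true C))
                  + ex (bernoulliWeight p) (ind (A ∩ secAt e false B ∩ secAt e false C)))
              + (ex (bernoulliWeight p) (ind (secAt e true B ∩ secAt e true C)) - ex (bernoulliWeight p) (ind (secAt e true B ∩ secAt e false C))
                  - ex (bernoulliWeight p) (ind (secAt e false B ∩ secAt e true C))
                  + ex (bernoulliWeight p) (ind (secAt e false B ∩ secAt e false C))) )
          + (1 - ex (bernoulliWeight p) (ind A))
              * (ex (bernoulliWeight p) (ind (secAt e true B)) - ex (bernoulliWeight p) (ind (secAt e false B)))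
              * (ex (bernoulliWeight p) (ind (secAt e true C)) - ex (bernoulliWeight p) (ind (secAt e false C))) )
      + (p e : ℝ) ^ 2 * (1 - (p e : ℝ)) *
        ( (2 - ex (bernoulliWeight p) (ind A)) *
              (ex (bernoulliWeight p) (ind (secAt e true B ∩ secAt e true C))
                - ex (bernoulliWeight p) (ind (secAt e true B)) * ex (bernoulliWeight p) (ind (secAt e true C)))
          + ( (ex (bernoulliWeight p) (ind (A ∩ secAt e true B ∩ secAt e false C))
                  - ex (bernoulliWeight p) (ind (A ∩ secAt e false C)) * ex (bernoulliWeight p) (ind (secAt e true B)))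
              + (ex (bernoulliWeight p) (ind (A ∩ secAt e false B ∩ secAt e true C))
                  - ex (bernoulliWeight p) (ind (A ∩ secAt e false B)) * ex (bernoulliWeight p) (ind (secAt e true C)))
              + (ex (bernoulliWeight p) (ind (secAt e true B ∩ secAt e false C)) - ex (bernoulliWeight p) (ind (secAt e false B ∩ secAt e false C))
                  - ex (bernoulliWeight p) (ind (A ∩ secAt e true B ∩ secAt e false C))
                  + ex (bernoulliWeight p) (ind (A ∩ secAt e false B ∩ secAt e false C)))
              + (ex (bernoulliWeight p) (ind (secAt e false B ∩ secAt e true C)) - ex (bernoulliWeight p) (ind (secAt e false B ∩ secAt e false C))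
                  - ex (bernoulliWeight p) (ind (A ∩ secAt e false B ∩ secAt e true C))
                  + ex (bernoulliWeight p) (ind (A ∩ secAt e false B ∩ secAt e false C)))
              + (ex (bernoulliWeight p) (ind (secAt e true B ∩ secAt e true C)) - ex (bernoulliWeight p) (ind (secAt e true B ∩ secAt e false C))
                  - ex (bernoulliWeight p) (ind (secAt e false B ∩ secAt e true C))
                  + ex (bernoulliWeight p) (ind (secAt e false B ∩ secAt e false C))) ) )
      + (p e : ℝ) ^ 3 *
        (ex (bernoulliWeight p) (ind (secAt e true B ∩ secAt e true C))
          - ex (bernoulliWeight p) (ind (secAt e true B)) * ex (bernoulliWeight p) (ind (secAt e true C))) := by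
  have hA : ex (bernoulliWeight p) (ind (A ∪ {ω : Set ι | e ∈ ω})) =
      (p e : ℝ) * ex (bernoulliWeight p) (ind (Set.univ : Set (Set ι))) + (1 - (p e : ℝ)) * ex (bernoulliWeight p) (ind A) :=
    ex_ind_of_secAt p e (by simp [hAe]) (by simp [hAe])
  have hB : ex (bernoulliWeight p) (ind B) = (p e : ℝ) * ex (bernoulliWeight p) (ind (secAt e true B)) +
      (1 - (p e : ℝ)) * ex (bernoulliWeight p) (ind (secAt e false B)) := ex_ind_eq_secAt p e B
  have hC : ex (bernoulliWeight p) (ind C) = (p e : ℝ) * ex (bernoulliWeight p) (ind (secAt e true C)) +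
      (1 - (p e : ℝ)) * ex (bernoulliWeight p) (ind (secAt e false C)) := ex_ind_eq_secAt p e C
  have hAB : ex (bernoulliWeight p) (ind ((A ∪ {ω : Set ι | e ∈ ω}) ∩ B)) =
      (p e : ℝ) * ex (bernoulliWeight p) (ind (secAt e true B)) + (1 - (p e : ℝ)) * ex (bernoulliWeight p) (ind (A ∩ secAt e false B)) :=
    ex_ind_of_secAt p e (by simp [hAe]) (by simp [hAe])
  have hAC : ex (bernoulliWeight p) (ind ((A ∪ {ω : Set ι | e ∈ ω}) ∩ C)) =
      (p e : ℝ) * ex (bernoulliWeight p) (ind (secAt e true C)) + (1 - (p e : ℝ)) * ex (bernoulliWeight p) (ind (A ∩ secAt e false C)) :=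
    ex_ind_of_secAt p e (by simp [hAe]) (by simp [hAe])
  have hBC : ex (bernoulliWeight p) (ind (B ∩ C)) = (p e : ℝ) * ex (bernoulliWeight p) (ind (secAt e true B ∩ secAt e true C)) +
      (1 - (p e : ℝ)) * ex (bernoulliWeight p) (ind (secAt e false B ∩ secAt e false C)) :=
    ex_ind_of_secAt p e (by simp) (by simp)
  have hABC : ex (bernoulliWeight p) (ind ((A ∪ {ω : Set ι | e ∈ ω}) ∩ B ∩ C)) =
      (p e : ℝ) * ex (bernoulliWeight p) (ind (secAt e true B ∩ secAt e true C)) +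
        (1 - (p e : ℝ)) * ex (bernoulliWeight p) (ind (A ∩ secAt e false B ∩ secAt e false C)) :=
    ex_ind_of_secAt p e (by simp [hAe]) (by simp [hAe])
  rw [sahiE_three, sahiE_three]
  simp only [ind_mul_ind_eq_inter]
  rw [hA, hB, hC, hAB, hAC, hBC, hABC, ex_ind_univ]
  ring

end Identity

/-! ### 2. Nonnegativity of the pieces for increasing events; inheritance of `C_3`; a Bernstein-good coordinate -/

section Consequences

variable (p : ι → unitInterval) (e : ι) {A B C : Set (Set ι)} (hA : IsUpperSet A) (hB : IsUpperSet B) (hC : IsUpperSet C)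
  (hAe : ∀ b : Bool, secAt e b A = A)
include hA hB hC

/-- **The bracket `W` is nonnegative** for increasing events: `W = Cov(A∩C⁰, B¹) + Cov(A∩B⁰, C¹) + m(Aᶜ∩(B¹∖B⁰)∩C⁰) + m(Aᶜ∩B⁰∩(C¹∖C⁰))
+ m((B¹∖B⁰)∩(C¹∖C⁰))`. [this work] -/
theorem bracketW_nonneg :
    0 ≤ (ex (bernoulliWeight p) (ind (A ∩ secAt e true B ∩ secAt e false C))
            - ex (bernoulliWeight p) (ind (A ∩ secAt e false C)) * ex (bernoulliWeight p) (ind (secAt e true B)))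
        + (ex (bernoulliWeight p) (ind (A ∩ secAt e false B ∩ secAt e true C))
            - ex (bernoulliWeight p) (ind (A ∩ secAt e false B)) * ex (bernoulliWeight p) (ind (secAt e true C)))
        + (ex (bernoulliWeight p) (ind (secAt e true B ∩ secAt e false C)) - ex (bernoulliWeight p) (ind (secAt e false B ∩ secAt e false C))
            - ex (bernoulliWeight p) (ind (A ∩ secAt e true B ∩ secAt e false C))
            + ex (bernoulliWeight p) (ind (A ∩ secAt e false B ∩ secAt e false C)))
        + (ex (bernoulliWeight p) (ind (secAt e false B ∩ secAt e true C)) - ex (bernoulliWeight p) (ind (secAt e false B ∩ secAt e false C))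
            - ex (bernoulliWeight p) (ind (A ∩ secAt e false B ∩ secAt e true C))
            + ex (bernoulliWeight p) (ind (A ∩ secAt e false B ∩ secAt e false C)))
        + (ex (bernoulliWeight p) (ind (secAt e true B ∩ secAt e true C)) - ex (bernoulliWeight p) (ind (secAt e true B ∩ secAt e false C))
            - ex (bernoulliWeight p) (ind (secAt e false B ∩ secAt e true C))
            + ex (bernoulliWeight p) (ind (secAt e false B ∩ secAt e false C))) := by
  have hB01 := RigidityAll.secAt_false_subset_secAt_true e hB
  have hC01 := RigidityAll.secAt_false_subset_secAt_true e hC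
  -- Harris: `Cov(A ∩ C⁰, B¹) ≥ 0`, `Cov(A ∩ B⁰, C¹) ≥ 0`
  have c1 : 0 ≤ ex (bernoulliWeight p) (ind (A ∩ secAt e true B ∩ secAt e false C))
      - ex (bernoulliWeight p) (ind (A ∩ secAt e false C)) * ex (bernoulliWeight p) (ind (secAt e true B)) := by
    have h := Pointwise.cov_ind_nonneg p (hA.inter (isUpperSet_secAt e false hC)) (isUpperSet_secAt e true hB)
    have hset : A ∩ secAt e false C ∩ secAt e true B = A ∩ secAt e true B ∩ secAt e false C := by
      ext ω; simp only [Set.mem_inter_iff]; tauto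
    rw [hset] at h
    exact h
  have c2 : 0 ≤ ex (bernoulliWeight p) (ind (A ∩ secAt e false B ∩ secAt e true C))
      - ex (bernoulliWeight p) (ind (A ∩ secAt e false B)) * ex (bernoulliWeight p) (ind (secAt e true C)) :=
    Pointwise.cov_ind_nonneg p (hA.inter (isUpperSet_secAt e false hB)) (isUpperSet_secAt e true hC)
  -- the two mixed cells and the product of the pivotal sets
  have c3 : 0 ≤ ex (bernoulliWeight p) (ind (secAt e true B ∩ secAt e false C)) - ex (bernoulliWeight p) (ind (secAt e false B ∩ secAt e false C))
      - ex (bernoulliWeight p) (ind (A ∩ secAt e true B ∩ secAt e false C))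
      + ex (bernoulliWeight p) (ind (A ∩ secAt e false B ∩ secAt e false C)) :=
    cell_nonneg p hB01 A (secAt e false C)
  have c4 : 0 ≤ ex (bernoulliWeight p) (ind (secAt e false B ∩ secAt e true C)) - ex (bernoulliWeight p) (ind (secAt e false B ∩ secAt e false C))
      - ex (bernoulliWeight p) (ind (A ∩ secAt e false B ∩ secAt e true C))
      + ex (bernoulliWeight p) (ind (A ∩ secAt e false B ∩ secAt e false C)) := by
    have h := cell_nonneg p hC01 (A ∩ secAt e false B) (secAt e false B)
    have e1 : secAt e true C ∩ secAt e false B = secAt e false B ∩ secAt e true C := Set.inter_comm _ _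
    have e2 : secAt e false C ∩ secAt e false B = secAt e false B ∩ secAt e false C := Set.inter_comm _ _
    have e3 : A ∩ secAt e false B ∩ secAt e true C ∩ secAt e false B = A ∩ secAt e false B ∩ secAt e true C := by
      ext ω; simp only [Set.mem_inter_iff]; tauto
    have e4 : A ∩ secAt e false B ∩ secAt e false C ∩ secAt e false B = A ∩ secAt e false B ∩ secAt e false C := by
      ext ω; simp only [Set.mem_inter_iff]; tauto
    rw [e1, e2, e3, e4] at h
    exact h
  have c5 : 0 ≤ ex (bernoulliWeight p) (ind (secAt e true B ∩ secAt e true C)) - ex (bernoulliWeight p) (ind (secAt e true B ∩ secAt e false C))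
      - ex (bernoulliWeight p) (ind (secAt e false B ∩ secAt e true C))
      + ex (bernoulliWeight p) (ind (secAt e false B ∩ secAt e false C)) :=
    cell_nonneg' p hB01 hC01
  linarith

/-- **`X₂ ≥ 0`** (the `t²(1−t)` coefficient): `(2 − mA)·Cov(B¹,C¹) + W ≥ 0` for increasing `A, B, C`. [this work] -/
theorem coeffX₂_nonneg :
    0 ≤ (2 - ex (bernoulliWeight p) (ind A)) *
          (ex (bernoulliWeight p) (ind (secAt e true B ∩ secAt e true C))
            - ex (bernoulliWeight p) (ind (secAt e true B)) * ex (bernoulliWeight p) (ind (secAt e true C)))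
        + ( (ex (bernoulliWeight p) (ind (A ∩ secAt e true B ∩ secAt e false C))
              - ex (bernoulliWeight p) (ind (A ∩ secAt e false C)) * ex (bernoulliWeight p) (ind (secAt e true B)))
          + (ex (bernoulliWeight p) (ind (A ∩ secAt e false B ∩ secAt e true C))
              - ex (bernoulliWeight p) (ind (A ∩ secAt e false B)) * ex (bernoulliWeight p) (ind (secAt e true C)))
          + (ex (bernoulliWeight p) (ind (secAt e true B ∩ secAt e false C)) - ex (bernoulliWeight p) (ind (secAt e false B ∩ secAt e false C))
              - ex (bernoulliWeight p) (ind (A ∩ secAt e true B ∩ secAt e false C))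
              + ex (bernoulliWeight p) (ind (A ∩ secAt e false B ∩ secAt e false C)))
          + (ex (bernoulliWeight p) (ind (secAt e false B ∩ secAt e true C)) - ex (bernoulliWeight p) (ind (secAt e false B ∩ secAt e false C))
              - ex (bernoulliWeight p) (ind (A ∩ secAt e false B ∩ secAt e true C))
              + ex (bernoulliWeight p) (ind (A ∩ secAt e false B ∩ secAt e false C)))
          + (ex (bernoulliWeight p) (ind (secAt e true B ∩ secAt e true C)) - ex (bernoulliWeight p) (ind (secAt e true B ∩ secAt e false C))
              - ex (bernoulliWeight p) (ind (secAt e false B ∩ secAt e true C))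
              + ex (bernoulliWeight p) (ind (secAt e false B ∩ secAt e false C))) ) := by
  have hW := bracketW_nonneg p e hA hB hC
  have cBC := Pointwise.cov_ind_nonneg p (isUpperSet_secAt e true hB) (isUpperSet_secAt e true hC)
  have mA : 0 ≤ 2 - ex (bernoulliWeight p) (ind A) := by
    have h := Pointwise.one_sub_ex_ind p A
    have h' : 0 ≤ ex (bernoulliWeight p) (ind Aᶜ) := ex_ind_nonneg' p _
    linarith
  linarith [mul_nonneg mA cBC]

/-- **`X₁ − E_3(minor) ≥ 0`** (the `t(1−t)²` coefficient minus the minor's `E_3`): `(1 − mA)·Cov(B¹,C¹) + W + (1−mA)·ν_B·ν_C ≥ 0`. [this work] -/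
theorem coeffX₁_sub_minor_nonneg :
    0 ≤ (1 - ex (bernoulliWeight p) (ind A)) *
          (ex (bernoulliWeight p) (ind (secAt e true B ∩ secAt e true C))
            - ex (bernoulliWeight p) (ind (secAt e true B)) * ex (bernoulliWeight p) (ind (secAt e true C)))
        + ( (ex (bernoulliWeight p) (ind (A ∩ secAt e true B ∩ secAt e false C))
              - ex (bernoulliWeight p) (ind (A ∩ secAt e false C)) * ex (bernoulliWeight p) (ind (secAt e true B)))
          + (ex (bernoulliWeight p) (ind (A ∩ secAt e false B ∩ secAt e true C))
              - ex (bernoulliWeight p) (ind (A ∩ secAt e false B)) * ex (bernoulliWeight p) (ind (secAt e true C)))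
          + (ex (bernoulliWeight p) (ind (secAt e true B ∩ secAt e false C)) - ex (bernoulliWeight p) (ind (secAt e false B ∩ secAt e false C))
              - ex (bernoulliWeight p) (ind (A ∩ secAt e true B ∩ secAt e false C))
              + ex (bernoulliWeight p) (ind (A ∩ secAt e false B ∩ secAt e false C)))
          + (ex (bernoulliWeight p) (ind (secAt e false B ∩ secAt e true C)) - ex (bernoulliWeight p) (ind (secAt e false B ∩ secAt e false C))
              - ex (bernoulliWeight p) (ind (A ∩ secAt e false B ∩ secAt e true C))
              + ex (bernoulliWeight p) (ind (A ∩ secAt e false B ∩ secAt e false C)))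
          + (ex (bernoulliWeight p) (ind (secAt e true B ∩ secAt e true C)) - ex (bernoulliWeight p) (ind (secAt e true B ∩ secAt e false C))
              - ex (bernoulliWeight p) (ind (secAt e false B ∩ secAt e true C))
              + ex (bernoulliWeight p) (ind (secAt e false B ∩ secAt e false C))) )
        + (1 - ex (bernoulliWeight p) (ind A))
            * (ex (bernoulliWeight p) (ind (secAt e true B)) - ex (bernoulliWeight p) (ind (secAt e false B)))
            * (ex (bernoulliWeight p) (ind (secAt e true C)) - ex (bernoulliWeight p) (ind (secAt e false C))) := by
  have hW := bracketW_nonneg p e hA hB hC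
  have cBC := Pointwise.cov_ind_nonneg p (isUpperSet_secAt e true hB) (isUpperSet_secAt e true hC)
  have mA : 0 ≤ 1 - ex (bernoulliWeight p) (ind A) := by rw [Pointwise.one_sub_ex_ind]; exact ex_ind_nonneg' p _
  have nB := Pointwise.ex_secAt_true_sub_false_nonneg p e hB
  have nC := Pointwise.ex_secAt_true_sub_false_nonneg p e hC
  have t1 := mul_nonneg mA cBC
  have t2 := mul_nonneg (mul_nonneg mA nB) nC
  linarith

include hAe

/-- **`C_3` is inherited from ONE minor under single-member disjunctive gluing, the other members ARBITRARY in `e`**: for increasing `A, B, C` with `A`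
`e`-free, `E_3(μ_p; A, B⁰, C⁰) ≥ 0 ⟹ E_3(μ_p; A ∪ {e∈ω}, B, C) ≥ 0`; indeed
`E_3(A ∪ {e∈ω}, B, C) ≥ ((1−t)³ + t(1−t)²)·E_3(A, B⁰, C⁰)`. [this work] -/
theorem sahiE_three_unionCoord_one_arb_ge_minor :
    ((1 - (p e : ℝ)) ^ 3 + (p e : ℝ) * (1 - (p e : ℝ)) ^ 2) *
        sahiE (bernoulliWeight p) 3 ![ind A, ind (secAt e false B), ind (secAt e false C)]
      ≤ sahiE (bernoulliWeight p) 3 ![ind (A ∪ {ω : Set ι | e ∈ ω}), ind B, ind C] := by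
  rw [sahiE_three_unionCoord_one_arb p e A B C hAe]
  have ht0 : 0 ≤ (p e : ℝ) := (p e).2.1
  have ht1 : 0 ≤ 1 - (p e : ℝ) := sub_nonneg.2 (p e).2.2
  have hX2 := coeffX₂_nonneg p e hA hB hC
  have hX1 := coeffX₁_sub_minor_nonneg p e hA hB hC
  have cBC := Pointwise.cov_ind_nonneg p (isUpperSet_secAt e true hB) (isUpperSet_secAt e true hC)
  have t2 := mul_nonneg (mul_nonneg ht0 (pow_nonneg ht1 2)) hX1
  have t3 := mul_nonneg (mul_nonneg (pow_nonneg ht0 2) ht1) hX2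
  have t4 := mul_nonneg (pow_nonneg ht0 3) cBC
  nlinarith [t2, t3, t4]

/-- **`C_3` inheritance** (vector-of-events form, as in `Pointwise.sahiE_three_unionCoord_two_free_nonneg`): for increasing `A, B, C` with `A` `e`-free,
`0 ≤ E_3(μ_p; A, B⁰, C⁰) ⟹ 0 ≤ E_3(μ_p; A ∪ {e∈ω}, B, C)`. [this work] -/
theorem sahiE_three_unionCoord_one_arb_nonneg
    (h0 : 0 ≤ sahiE (bernoulliWeight p) 3 (fun j => ind ((![A, secAt e false B, secAt e false C] : Fin 3 → Set (Set ι)) j))) :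
    0 ≤ sahiE (bernoulliWeight p) 3 (fun j => ind ((![A ∪ {ω : Set ι | e ∈ ω}, B, C] : Fin 3 → Set (Set ι)) j)) := by
  rw [Pointwise.ind_vec3] at h0 ⊢
  have hge := sahiE_three_unionCoord_one_arb_ge_minor p e hA hB hC hAe
  have ht0 : 0 ≤ (p e : ℝ) := (p e).2.1
  have ht1 : 0 ≤ 1 - (p e : ℝ) := sub_nonneg.2 (p e).2.2
  have hc : 0 ≤ ((1 - (p e : ℝ)) ^ 3 + (p e : ℝ) * (1 - (p e : ℝ)) ^ 2) :=
    add_nonneg (pow_nonneg ht1 3) (mul_nonneg ht0 (pow_nonneg ht1 2))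
  have := mul_nonneg hc h0
  linarith

end Consequences

/-! ### 3. Intrinsic form: a member IMPLIED by `e` -/

/-- **Intrinsic form.**  If an increasing triple has a member `U₀ ⊇ {e ∈ ω}` (the member is IMPLIED by `e`), then `C_3` for the triple follows from `C_3` for the
single minor `(U₀⁰, U₁⁰, U₂⁰)` of `0`-sections — whatever `U₁, U₂` do with `e`. [this work] -/
theorem sahiE_three_nonneg_of_coordEvent_subset_member (p : ι → unitInterval) (e : ι) {U₀ U₁ U₂ : Set (Set ι)}
    (h₀ : IsUpperSet U₀) (h₁ : IsUpperSet U₁) (h₂ : IsUpperSet U₂) (he : {ω : Set ι | e ∈ ω} ⊆ U₀)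
    (hmin : 0 ≤ sahiE (bernoulliWeight p) 3
      (fun j => ind ((![secAt e false U₀, secAt e false U₁, secAt e false U₂] : Fin 3 → Set (Set ι)) j))) :
    0 ≤ sahiE (bernoulliWeight p) 3 (fun j => ind ((![U₀, U₁, U₂] : Fin 3 → Set (Set ι)) j)) := by
  have hrec : secAt e false U₀ ∪ {ω : Set ι | e ∈ ω} = U₀ := Pointwise.secAt_false_union_coordEvent_of_superset e h₀ he
  have h := sahiE_three_unionCoord_one_arb_nonneg p e (isUpperSet_secAt e false h₀) h₁ h₂
    (fun b => Pointwise.secAt_secAt_same e b false U₀) hmin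
  rw [hrec] at h
  exact h

end SahiCoordinateGluing

end Summit.CriticalPhenomena.PercolationContinuityZ3.Theorems
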